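import Summits.BirchSwinnertonDyer.Rank1Residual.X11b.RouteP2OpenInputFromPrint
import Summits.BirchSwinnertonDyer.Rank1Residual.X11b.BDPRouteTwistCertificateRecord
import Summits.BirchSwinnertonDyer.Rank1Residual.Supersingular.X6RankOnePrimeConductor
import Literature.NumberTheory.EllipticCurves.Rank1Residual.X9NoEntry
import HarnessLib

/-!
# Class X11b, route p2 at `p ≥ 5`: THE OPEN INPUT IN PRINT CURRENCY ON EVERY SEMISTABLE PAIR, and the
# semistable end state — PUB + cited + ONE OPEN divisibility + at most ONE `p`-adic height per pair
# (cell `b2b-bsdres`, sub-cell `multr1-p2`, gen 23)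

HONEST FRAMING (cell `b2b-bsdres`, run/shared/lean/b2b/bsd-rank1-residual/, verbatim in every
file): the goal of the cell is to DELETE the COMBINATION-SHAPED residual classes of the
Birch–Swinnerton-Dyer formula for ALL analytic-rank `≤ 1` elliptic curves over `ℚ` — "full BSD
formula for every rank `≤ 1` curve in class `C`" assembled STRICTLY from published theorems — so
that the rank-`≤ 1` remainder becomes exactly the CONSTRUCTION-SHAPED classes, which are TYPED
(missing-input `Prop`s), NOT attempted. This is not "finishing BSD". Sub-cell `multr1-p2` is a
RESEARCH ROUTE on class X11b (`ClassX11b W p := r_an = 1 ∧ p ≠ 2 ∧ mult(p) ∧ irr(p)`,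
`Partition/Rows.lean`); no claim beyond the stated class and loci; X11b's label does not change;
NOTHING is booked by this file.

THEOREMS ONLY (no definition, no named fact, no `sorry`). The PUBLISHED fact
`Castella2018.thm32_exists_isBDPLFunction_valueAtOne` (Cas18 Thms. 3.1–3.2, squarefree `N`) enters as
the hypothesis `h32`; every result using the OPEN shape `P2.IMCDivOnTree` (multr1-p1 gen 21,
`RouteP2OpenInputFromPrint.lean`: the one-sided divisibility (2.4) `Ch_Λ(X_ac)·R₀⟦T⟧ ⊆ (L)` for every
frame `L` of Castella's published `L_p(f)` at route p2's data) is CONDITIONAL.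

## What this file does

multr1-p1's adapter `P2.openInputOnTreeAt_of_imcDiv` derives route p2's open input
`P2OpenInputOnTreeAt W p` from `h32` + (2.4) + the control IDENTITY `P2ControlOnTreeAt W p` — a
theorem only on the Locus (x11b3-p9's `p2ControlOnTreeAt_of_locus`) or from Castella's Thm. 2.3 as a
named hypothesis. OBSERVATION: the derivation uses the control identity ONLY through
`∃ n, HasCharValuationAt … n` (the constructed `X_ac` is `Λ`-torsion with `f_ac(0) ≠ 0`), and this is
already supplied by the ONE-SIDED control `P2ControlUpperOnTreeAt W p`, which gens 13–17 of this
sub-cell made a THEOREM ON EVERY PAIR from Kolyvagin + Poitou–Tate + Tate's local Euler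
characteristic (`p2ControlUpperOnTreeAt_of_facts`; no (iv), no Locus, no identity). Hence:

* §1 `P2.openInputOnTreeAt_of_imcDiv_of_controlUpper`, **`P2.openInputOnTreeAt_of_imcDiv_of_facts`**:
  on EVERY SEMISTABLE pair, `P2OpenInputOnTreeAt W p` ⇐ `h32` + `hnf` + `hGZK` + Kolyvagin +
  Poitou–Tate + local Euler characteristic + the ONE OPEN input `P2.IMCDivOnTree W p`. Census
  (multr1-p1 `census500k`, recount `census23/` in the seat dir, `N < 5·10⁵ ‖ N < 2·10⁴`): the
  semistable part of the X11b shape at `p ≥ 5` is 753 185 ‖ 30 086 of 2 267 348 ‖ 70 420 pairs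
  (Locus 723 144 ‖ 28 657; (ram) ∧ `p ∣ ∏c` 27 524 ‖ 1 199; ¬(ram) 2 517 ‖ 230).
* §2 THE SEMISTABLE SHAPE IN THE KERNEL: NO corner on semistable pairs (Serre 1972 Prop. 21 i), the
  tree theorem `surj_of_irr_of_semistable`; at class level hyp's
  `Partition.surj_of_classX11b_of_semistable`), `conductorNorm_eq_of_semistable_of_forall_not_mult`
  (semistable with `p` the only multiplicative prime ⟹ `N = p`),
  **`not_split_of_classX11b_of_semistable_of_forall_not_mult`** (then `r_an = 1` forces NON-split
  reduction at `p` by the root number — lit-cw's `Supersingular.mult_and_not_split_of_conductorNorm_prime_of_odd_analyticRank`: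
  the (T2∗) residue "split at `p`, no other multiplicative prime" is EMPTY on semistable pairs, so
  Disegni's (∗) holds at every semistable split pair, `disegniStar_of_classX11b_of_semistable`).
* The RECORDS (pair-level semistable end state `P2.bsdp_of_semistable_of_imcDiv`, class-level
  `P2.bsdp_of_onTree_print`) are in the companion `X11b/BDPRouteOpenInputPrintRecord.lean`.

CONDITIONAL on (2.4) (⇐ [FW21, Thm. 4.41], PREPRINT); deletes nothing; labels UNCHANGED; X11b stays
CONSTRUCTION-SHAPED; REG / TC remain per-pair certificates whose class-wide existence is not in print.

References: [Castella2018] Thms. 2.3, 3.1, 3.2, §5 (arXiv:1704.06608 pp. 5, 9, 12);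
[Castella2018Erratum] (2.4), Thm. 1.1; [FouquetWan2021] Thm. 4.41; [Serre1972] §5.4 Prop. 21;
[KellockDokchitser2023] Cor. 2.5; [Disegni2020] Thm. 1, (∗); [McCallumLMS1991] §1; [Miller2011LMS] Def. 1.1.
-/

noncomputable section

open scoped Classical NumberField

open WeierstrassCurve NumberField IsDedekindDomain Field PowerSeries
open Literature.NumberTheory.EllipticCurves Literature.NumberTheory.EllipticCurves.GreenbergSelmer
open Literature.NumberTheory.EllipticCurves.ModularForms
open Literature.NumberTheory.EllipticCurves.Rank1Residual
open Literature.NumberTheory.EllipticCurves.Rank1Residual.Typed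
open Literature.NumberTheory.EllipticCurves.Wuthrich2014
open Literature.NumberTheory.EllipticCurves.Castella2018
open Literature.NumberTheory.EllipticCurves.SteinWuthrich2013
open Literature.NumberTheory.EllipticCurves.Disegni2020
open Literature.NumberTheory.EllipticCurves.Skinner2016
open Literature.NumberTheory.EllipticCurves.BalakrishnanEtAl2019
open Literature.NumberTheory.QuadraticFields.Quadratic
open Literature.NumberTheory.GaloisRepresentations Literature.NumberTheory.GaloisCohomology
open Summit.BirchSwinnertonDyer.Rank1Residual.X11b.AcSelmer
open Summit.BirchSwinnertonDyer.Rank1Residual.X11b.Halves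

namespace Summit.BirchSwinnertonDyer.Rank1Residual.X11b

/-! ### §1 The open input of route p2 from print ∧ (2.4), on EVERY semistable pair -/

section Print

variable {W : WeierstrassCurve ℚ} [W.IsElliptic] [W.IsGloballyMinimal] {p : ℕ} [Fact p.Prime]

/-- **Route p2's open input FROM PRINT ∧ (2.4) with the ONE-SIDED control.** multr1-p1's
`P2.openInputOnTreeAt_of_imcDiv` VERBATIM except that the control IDENTITY `P2ControlOnTreeAt W p`
is replaced by the one-sided `P2ControlUpperOnTreeAt W p`: its proof only extracts
`HasCharValuationAt … n` (torsion `X_ac`, `f_ac(0) ≠ 0`) from the control input before calling team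
x11b3's pointwise assembly `Halves.imcLowerWaldspurgerOnTreeAt_of_value_of_dvd`. Given `h32` (Cas18
Thms. 3.1–3.2), `hnf`, `hGZK`, one embedding datum `ι₀`, a SEMISTABLE pair and the OPEN half
`P2.IMCDivOnTree W p`: `P2OpenInputOnTreeAt W p`. CONDITIONAL on the open half.
[cite: Castella2018, Thms. 2.3, 3.1, 3.2 and §5 (arXiv:1704.06608 pp. 5, 9, 12)]
[cite: Castella2018Erratum, (2.4) and Thm. 1.1 (pp. 1, 4)] -/
theorem P2.openInputOnTreeAt_of_imcDiv_of_controlUpper (h32 : thm32_exists_isBDPLFunction_valueAtOne)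
    (hnf : exists_isNewformOf) (hGZK : rank_eq_analyticRank_of_analyticRank_le_one)
    (hC : P2ControlUpperOnTreeAt W p) (ι₀ : PadicAlgCl p ≃+* ℂ) (hss : Semistable W)
    (h3 : P2.IMCDivOnTree W p) : P2OpenInputOnTreeAt W p := by
  intro N _ K _ _ Dt H ιK P hX h5 hs hN hK hodd hpd hμ hHN hLt hP hc hPinf κ hκ γ _ 𝔭 h𝔭 he hf
  obtain ⟨n, hn, -⟩ := hC N K Dt H ιK P hX h5 hs hN hK hodd hpd hμ hHN hLt hP hc hPinf κ hκ γ 𝔭 h𝔭 he hf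
  have h3' := h3 N K Dt H ιK P hX h5 hs hN hK hodd hpd hμ hHN hLt hP hc hPinf κ hκ γ
  subst hN
  obtain ⟨hr, -, hmult, hirr⟩ := hX
  obtain ⟨w₀⟩ := (inferInstance : Nonempty (InfinitePlace K))
  have hp2 : p ≠ 2 := by omega
  have hpN : p ∣ W.conductorNorm ℤ := dvd_conductorNorm_of_mult hmult
  -- `rank_ℤ E(K) = 1` (Gross–Zagier–Kolyvagin)
  have hrk : (W.baseChange K).mordellWeilRank = 1 :=
    mordellWeilRank_baseChange_eq_one_of_twist_ne_zero W hGZK hnf hr hK.1 hLt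
  -- the datum's complex embedding is `w₀.embedding ∘ τ` for some `τ ∈ Gal(K/ℚ)`, `τ² = 1`
  haveI : IsGalois ℚ K := by
    haveI : Algebra.IsQuadraticExtension ℚ K := ⟨hK.1⟩
    infer_instance
  obtain ⟨σ, hσ⟩ := ComplexEmbedding.exists_comp_symm_eq_of_comp_eq (k := ℚ) w₀.embedding ιK
    (by ext x; simp)
  set τ : K →+* K := ((σ.symm : K ≃ₐ[ℚ] K) : K →+* K) with hτdef
  have hτ : ∀ x, τ (τ x) = x := by
    intro x
    have hcard : Nat.card (K ≃ₐ[ℚ] K) = 2 := by rw [IsGalois.card_aut_eq_finrank, hK.1]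
    have hsq : σ.symm * σ.symm = 1 := by
      have h := pow_card_eq_one' (G := K ≃ₐ[ℚ] K) (x := σ.symm)
      rwa [hcard, pow_two] at h
    have := congrArg (fun g : K ≃ₐ[ℚ] K ↦ g x) hsq
    simpa [hτdef, AlgEquiv.mul_apply] using this
  -- the Galois conjugate `P' = τ_* P` is the Heegner point read through `w₀.embedding`
  set P' := WeierstrassCurve.Affine.Point.map τ.toRatAlgHom P with hP'def
  have hP' : WeierstrassCurve.Affine.Point.map w₀.embedding.toRatAlgHom P' =
      heegnerPointComplex Dt H := by
    rw [hP'def, WeierstrassCurve.Affine.Point.map_map]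
    have hcomp : w₀.embedding.toRatAlgHom.comp τ.toRatAlgHom = ιK.toRatAlgHom := by
      apply AlgHom.ext
      intro x
      have := RingHom.congr_fun hσ x
      simpa [hτdef] using this
    rw [hcomp]
    exact hP
  have hlog : ∀ e : K →+* ℚ_[p], padicLogOrd W p e P' = padicLogOrd W p e P := fun e ↦
    R1.padicLogOrd_map_eq_of_rank_one W p e P hp2 τ hτ hrk hPinf
  -- THE embedding at `𝔭` induces `𝔭`
  have hemb : ∀ k : 𝓞 K, k ∈ 𝔭.asIdeal ↔ ‖embAt K p 𝔭 h𝔭 he hf (k : K)‖ < 1 :=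
    mem_asIdeal_iff_norm_embAt_lt_one 𝔭 h𝔭 he hf
  -- every degree-one prime above `p` is induced by `ι₀` or by `ι₀ ∘ conj`
  have key : ∀ ι' : PadicAlgCl p ≃+* ℂ, 𝔭 = primeOfEmbeddingDatum p ι' w₀.embedding →
      IMCLowerWaldspurgerOnTreeAt p κ 𝔭 γ (embAt K p 𝔭 h𝔭 he hf) P := by
    intro ι' h𝔭eq
    subst h𝔭eq
    obtain ⟨ΩK, Ωp, L, -, hL, u, hu⟩ :=
      R1.exists_frame_bdpValueAtOneOnTreeAt_of_satisfiesHeegnerHypothesis h32 ι' Dt H h5 hss hirr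
        hpN hK hHN hc w₀ hP' κ hκ γ Fact.out hemb
    refine imcLowerWaldspurgerOnTreeAt_of_padicLogOrd_eq W p _ (hlog _) ?_
    exact imcLowerWaldspurgerOnTreeAt_of_value_of_dvd hn
      (h3' Dt.f Dt.isNewformOf ι' w₀ ΩK Ωp L hL) u (W.LFunction p) hu
  rcases eq_primeOfEmbeddingDatum_or_eq_trans_starRingAut p ι₀ hK w₀ h𝔭 with h | h
  · exact key ι₀ h
  · exact key _ h

/-- **THE OPEN INPUT OF ROUTE p2 IN PRINT CURRENCY, ON EVERY SEMISTABLE PAIR.** For a globally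
minimal SEMISTABLE `W/ℚ` and a prime `p`: `P2OpenInputOnTreeAt W p` (the composite (IMC≥)∘(BDP) at
`𝟙` at every odd Manin-good Heegner datum of the pair, every anticyclotomic `(κ, γ)`, every
degree-one `𝔭`, THE embedding) follows from the PUBLISHED facts `h32` (Castella 2018 Thms. 3.1–3.2),
`hnf` (modularity), `hGZK`, `hKo` (Kolyvagin: `Ш(E/K)` finite), the CITED textbook facts `hPT`
(Poitou–Tate, Milne I 4.10) and `hEP` (Tate's local Euler characteristic, Milne I 2.8) — through the
sub-cell's one-sided control theorem `p2ControlUpperOnTreeAt_of_facts` (gens 13–17) — and the ONE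
OPEN input `P2.IMCDivOnTree W p` = (2.4) for Castella's `L_p(f)`. No Locus hypothesis, no control
identity, no (iv). CONDITIONAL on (2.4). [cite: Castella2018, Thms. 2.3, 3.1, 3.2, §5 (arXiv:1704.06608 pp. 5, 9, 12)]
[cite: Castella2018Erratum, (2.4) (p. 4)] [cite: MilneADT2006, Ch. I, Thm. 4.10(b) and Thm. 2.8] -/
theorem P2.openInputOnTreeAt_of_imcDiv_of_facts (h32 : thm32_exists_isBDPLFunction_valueAtOne)
    (hnf : exists_isNewformOf) (hGZK : rank_eq_analyticRank_of_analyticRank_le_one)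
    (hKo : ∀ (N : ℕ) [NeZero N] (W : WeierstrassCurve ℚ) (K : Type) [Field K] [NumberField K],
      kolyvagin N W K)
    (hPT : ∀ (K : Type) [Field K] [NumberField K], poitouTate_sum_localTatePairing_eq_zero K)
    (hEP : ∀ (K : Type) [Field K] [NumberField K] (v : HeightOneSpectrum (𝓞 K)),
      localEulerPoincareCharacteristic (v.adicCompletion K))
    (hss : Semistable W) (h3 : P2.IMCDivOnTree W p) : P2OpenInputOnTreeAt W p := by
  obtain ⟨ι₀⟩ := PadicAlgCl.nonempty_ringEquiv_complex p
  exact P2.openInputOnTreeAt_of_imcDiv_of_controlUpper h32 hnf hGZK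
    (p2ControlUpperOnTreeAt_of_facts W p hKo hPT hEP) ι₀ hss h3

/-- Bookkeeping: route p2's open input is vacuous off `X11b ∧ p ≥ 5`, so a proof of it under these
two hypotheses is a proof of it. [folklore] -/
theorem p2OpenInputOnTreeAt_of_imp (h : ClassX11b W p → 5 ≤ p → P2OpenInputOnTreeAt W p) :
    P2OpenInputOnTreeAt W p :=
  fun N _ K _ _ Dt H ι P hX hp5 ↦ h hX hp5 N K Dt H ι P hX hp5

end Print

/-! ### §2 The semistable shape in the kernel: no corner, no split-only residue -/

section Shape

variable {W : WeierstrassCurve ℚ} [W.IsElliptic] [W.IsGloballyMinimal] {p : ℕ} [Fact p.Prime]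

omit [W.IsGloballyMinimal] in
/-- **A semistable curve whose only multiplicative prime is `p` has conductor `p`** (square-free
conductor supported on the bad primes, all multiplicative). [folklore] -/
theorem conductorNorm_eq_of_semistable_of_forall_not_mult (hss : Semistable W) (hmult : Mult W p)
    (hm : ¬ ∃ (m : ℕ) (_ : Fact m.Prime), m ≠ p ∧ W.HasMultiplicativeReductionAtPrime m) :
    W.conductorNorm ℤ = p := by
  have hp : p.Prime := Fact.out
  have hsq : Squarefree (W.conductorNorm ℤ) := squarefree_conductorNorm_of_semistable hss
  have hpN : p ∣ W.conductorNorm ℤ := dvd_conductorNorm_of_mult hmult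
  have hN0 : W.conductorNorm ℤ ≠ 0 := hsq.ne_zero
  -- every prime factor of `N` is `p`
  have hall : ∀ {d : ℕ}, d.Prime → d ∣ W.conductorNorm ℤ → d = p := by
    intro d hd hdN
    haveI : Fact d.Prime := ⟨hd⟩
    have hbad : ¬ W.HasGoodReductionAtPrime d :=
      (W.dvd_conductorNorm_iff_not_hasGoodReductionAtPrime d).mp hdN
    have hmd : W.HasMultiplicativeReductionAtPrime d := (hss d hd).resolve_left hbad
    by_contra hne
    exact hm ⟨d, ⟨hd⟩, hne, hmd⟩
  obtain ⟨k, hk⟩ : ∃ k : ℕ, W.conductorNorm ℤ = p ^ k :=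
    ⟨_, Nat.eq_prime_pow_of_unique_prime_dvd hN0 (fun hd hdN ↦ hall hd hdN)⟩
  rw [hk] at hpN hsq
  rw [hk]
  have hk0 : k ≠ 0 := by
    rintro rfl
    rw [pow_zero, Nat.dvd_one] at hpN
    exact hp.one_lt.ne' hpN
  have hk2 : k < 2 := by
    by_contra hge
    have hge' : 2 ≤ k := not_lt.mp hge
    have hdvd : p * p ∣ p ^ k := by rw [← pow_two]; exact pow_dvd_pow p hge'
    exact hp.one_lt.ne' (Nat.isUnit_iff.mp (hsq p hdvd))
  obtain rfl : k = 1 := by omega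
  rw [pow_one]

omit [W.IsGloballyMinimal] in
/-- **The (T2∗) residue is EMPTY on semistable pairs**: for `(E,p)` in X11b with `E` semistable and
`p` the ONLY multiplicative prime, `E` is NOT split multiplicative at `p` — the conductor is `p`
(`conductorNorm_eq_of_semistable_of_forall_not_mult`) and a curve of prime conductor and odd analytic
rank is non-split at its conductor by the sign of the functional equation (`w(E) = −w_p(E)`, Atkin–Lehner
at square-free level + Rohrlich; lit-cw's tree theorem
`Supersingular.mult_and_not_split_of_conductorNorm_prime_of_odd_analyticRank`, from modularity `hnf`).
[cite: KellockDokchitser2023, Def. 2.1, Rem. 2.2 and Cor. 2.5] [cite: Rohrlich1993Compositio, Prop. 2(ii)] -/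
theorem not_split_of_classX11b_of_semistable_of_forall_not_mult (hnf : exists_isNewformOf)
    (hX : ClassX11b W p) (hss : Semistable W)
    (hm : ¬ ∃ (m : ℕ) (_ : Fact m.Prime), m ≠ p ∧ W.HasMultiplicativeReductionAtPrime m) :
    ¬ W.HasSplitMultiplicativeReductionAtPrime p :=
  (Supersingular.mult_and_not_split_of_conductorNorm_prime_of_odd_analyticRank hnf W p
    (conductorNorm_eq_of_semistable_of_forall_not_mult hss hX.2.2.1 hm)
    (by rw [hX.1]; exact odd_one)).2

omit [W.IsGloballyMinimal] in
/-- **Disegni's (∗) holds at every semistable X11b pair**: if `E` is split multiplicative at `p`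
there is a SECOND multiplicative prime (else `N = p` and `E` would be non-split at `p`).
[cite: Disegni2020, Thm. 1 (§1.2), hypothesis (∗)] [cite: KellockDokchitser2023, Cor. 2.5] -/
theorem disegniStar_of_classX11b_of_semistable (hnf : exists_isNewformOf) (hX : ClassX11b W p)
    (hss : Semistable W) :
    W.HasSplitMultiplicativeReductionAtPrime p →
      ∃ (m : ℕ) (_ : Fact m.Prime), m ≠ p ∧ W.HasMultiplicativeReductionAtPrime m := by
  intro hsplit
  by_contra hm
  exact not_split_of_classX11b_of_semistable_of_forall_not_mult hnf hX hss hm hsplit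

end Shape

end Summit.BirchSwinnertonDyer.Rank1Residual.X11b

end
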